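import Summits.Ventures.YMGap.FlowData.TubeTransferOperator
import Literature.MathematicalPhysics.QuantumLattice.SU2Haar
import Summits.Ventures.LatticeQCDFlow.Scoring.SU2HaarClassAngle
import Mathlib.MeasureTheory.Integral.Pi
import HarnessLib

/-!
# Venture YMGap, track Y3 FLOW-DATA — the HAAR CHAIN of a Polyakov line: independent link variables with a
# Schur-scalar weight act on `Re tr ρ(c₀a₀ c₁a₁ ⋯ c_{m−1}a_{m−1})` by the scalar `λ^m` (theorems only)

HONEST FRAMING: venture file of the cell `pub-ymgap` (QuantumFields programme), track Y3; group-theoretic lemmas for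
`FlowData/TubeFluxNonAnnihilation.lean` (the Polyakov-line state is not annihilated by the tube transfer operator).
Finite-dimensional Haar integrals only; no number, no row, nothing about limits or a mass gap.

* `integral_mul_trace_mul_eq` — if the weighted Haar average of the representation matrix is a SCALAR,
  `∫ w(c) ρ(c)_{ij} dc = λ δ_{ij}` (Schur's lemma for a central weight and an irreducible `ρ`; here a hypothesis),
  then `∫ w(c) tr(A ρ(c) B) dc = λ tr(A B)` for all matrices `A`, `B`;
* **`integral_prod_mul_trace_chain`** — for `m` INDEPENDENT Haar variables `c₀, …, c_{m−1}` with that weight,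
  `∫ (∏ₜ w(cₜ)) tr(A ρ(c₀a₀ c₁a₁ ⋯ c_{m−1}a_{m−1}) B) dc = λ^m tr(A ρ(a₀a₁⋯a_{m−1}) B)` (induction on `m`, splitting
  off the first variable by `measurePreserving_piFinSuccAbove` and Fubini), with its real-part form
  `integral_prod_mul_re_trace_chain`;
* **`su2_integral_exp_mul_apply`** — the hypothesis for `SU(2)`, fundamental representation, Wilson weight
  `w(U) = exp(J Re tr U)`: `∫ w(U) U_{ij} dU = λ_J δ_{ij}` with `λ_J = ∫ exp(2J a₀(U)) a₀(U) dU` (inversion invariance of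
  the Haar measure and `U⁻¹ = U†`, `U₁₁ = conj U₀₀`, `U₁₀ = −conj U₀₁`), and the class-angle (Weyl) evaluations
  `su2_weightMass_eq` / `su2_schurScalar_eq`: `∫ exp(2J a₀) = (2/π) Z₂(2J)`, `λ_J = (2/π) Z₂(2J)·⟨cos⟩_{2J}`, so that
  `λ_J / ∫ w = u(2J) = I₂(2J)/I₁(2J)` (`su2_schurScalar_div_weightMass`).

References: T. Bröcker, T. tom Dieck, *Representations of Compact Lie Groups* (1985) II (4.8), IV (1.11)
[cite: MontvayMunster1994, §3.2.6]; M. Creutz, *Quarks, gluons and lattices* (1983) (8.20) [folklore].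
-/

noncomputable section

open scoped BigOperators
open MeasureTheory Filter Function
open Literature.MathematicalPhysics.QuantumFieldTheory

namespace Summit.Ventures.YMGap.FlowData

/-! ### The Schur-scalar trace identity and the Haar chain (any compact group) -/

section General

variable {G : Type*} [Group G] [TopologicalSpace G] [IsTopologicalGroup G] [CompactSpace G]
  [MeasurableSpace G] [BorelSpace G] {n : ℕ} (ρ : G →* Matrix (Fin n) (Fin n) ℂ)

omit [CompactSpace G] [MeasurableSpace G] [BorelSpace G] in
/-- The ordered product `c₀a₀ ⋯ c_{m−1}a_{m−1}` is continuous in `c`. [folklore] -/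
theorem continuous_ofFn_mul_prod : ∀ (m : ℕ) (a : Fin m → G),
    Continuous fun y : Fin m → G => (List.ofFn fun t => y t * a t).prod
  | 0, a => by simp only [List.ofFn_zero, List.prod_nil]; exact continuous_const
  | m + 1, a => by
    simp only [List.ofFn_succ, List.prod_cons]
    exact ((continuous_apply 0).mul continuous_const).mul
      ((continuous_ofFn_mul_prod m (fun t => a t.succ)).comp (continuous_pi fun i => continuous_apply _))

/-- `tr(A X B) = Σ_{l,j} X_{lj} (B A)_{jl}`. [folklore] -/
theorem trace_mul_mul_eq_sum (A X B : Matrix (Fin n) (Fin n) ℂ) :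
    (A * X * B).trace = ∑ l, ∑ j, X l j * (B * A) j l := by
  rw [Matrix.trace_mul_cycle, Matrix.trace_mul_comm]
  set C := B * A
  simp only [Matrix.trace, Matrix.diag_apply, Matrix.mul_apply]

omit [IsTopologicalGroup G] [CompactSpace G] [MeasurableSpace G] [BorelSpace G] in
/-- Continuity of `c ↦ w(c) ρ(c)_{ij}` (as a complex function). [folklore] -/
theorem continuous_weight_mul_apply {w : G → ℝ} (hw : Continuous w) (hρ : Continuous ρ) (i j : Fin n) :
    Continuous fun c => (w c : ℂ) * ρ c i j :=
  (Complex.continuous_ofReal.comp hw).mul ((hρ.matrix_elem i j))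

/-- **Schur-scalar trace identity**: if `∫ w(c) ρ(c)_{ij} dc = λ δ_{ij}` then `∫ w(c) tr(A ρ(c) B) dc = λ tr(A B)`.
[folklore] -/
theorem integral_mul_trace_mul_eq {w : G → ℝ} (hw : Continuous w) (hρ : Continuous ρ) {lam : ℝ}
    (hM : ∀ i j, ∫ c, (w c : ℂ) * ρ c i j ∂haarProbability G = if i = j then (lam : ℂ) else 0)
    (A B : Matrix (Fin n) (Fin n) ℂ) :
    ∫ c, (w c : ℂ) * (A * ρ c * B).trace ∂haarProbability G = lam * (A * B).trace := by
  have hint : ∀ l j, Integrable (fun c => (w c : ℂ) * ρ c l j * (B * A) j l) (haarProbability G) := fun l j =>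
    ((continuous_weight_mul_apply ρ hw hρ l j).mul continuous_const).integrable_of_hasCompactSupport
      (HasCompactSupport.of_compactSpace _)
  simp_rw [trace_mul_mul_eq_sum, Finset.mul_sum, ← mul_assoc]
  rw [integral_finsetSum _ fun l _ => integrable_finsetSum _ fun j _ => hint l j]
  simp_rw [integral_finsetSum _ fun j _ => hint _ j, integral_mul_const, hM]
  simp only [ite_mul, zero_mul, Finset.sum_ite_eq, Finset.mem_univ, if_true]
  rw [Matrix.trace_mul_comm, ← Finset.mul_sum]
  simp only [Matrix.trace, Matrix.diag_apply]

/-- Real form: `∫ w(c) Re tr(A ρ(c) B) dc = λ Re tr(A B)`. [folklore] -/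
theorem integral_mul_re_trace_mul_eq {w : G → ℝ} (hw : Continuous w) (hρ : Continuous ρ) {lam : ℝ}
    (hM : ∀ i j, ∫ c, (w c : ℂ) * ρ c i j ∂haarProbability G = if i = j then (lam : ℂ) else 0)
    (A B : Matrix (Fin n) (Fin n) ℂ) :
    ∫ c, w c * (A * ρ c * B).trace.re ∂haarProbability G = lam * (A * B).trace.re := by
  have hc : Continuous fun c => (w c : ℂ) * (A * ρ c * B).trace :=
    (Complex.continuous_ofReal.comp hw).mul
      ((continuous_const.mul hρ).mul continuous_const).matrix_trace
  have hint : Integrable (fun c => (w c : ℂ) * (A * ρ c * B).trace) (haarProbability G) :=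
    hc.integrable_of_hasCompactSupport (HasCompactSupport.of_compactSpace _)
  have h1 : (fun c => w c * (A * ρ c * B).trace.re) = fun c => RCLike.re ((w c : ℂ) * (A * ρ c * B).trace) := by
    funext c
    simp only [RCLike.re_to_complex, Complex.re_ofReal_mul]
  rw [h1, integral_re hint, integral_mul_trace_mul_eq ρ hw hρ hM]
  simp only [RCLike.re_to_complex, Complex.re_ofReal_mul]

/-- **The Haar chain of a Polyakov line.**  For `m` independent Haar-distributed link variables `c₀, …, c_{m−1}`
weighted by `w` with `∫ w(c) ρ(c)_{ij} dc = λ δ_{ij}`: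
`∫ (∏ₜ w(cₜ)) tr(A ρ(c₀a₀ ⋯ c_{m−1}a_{m−1}) B) dc = λ^m tr(A ρ(a₀ ⋯ a_{m−1}) B)` — integrate the variables one at a
time from the left (`measurePreserving_piFinSuccAbove`, Fubini, the trace identity with `A ↦ A ρ(c₀a₀)`).
[folklore] -/
theorem integral_prod_mul_trace_chain [SecondCountableTopology G] {w : G → ℝ} (hw : Continuous w)
    (hρ : Continuous ρ) {lam : ℝ}
    (hM : ∀ i j, ∫ c, (w c : ℂ) * ρ c i j ∂haarProbability G = if i = j then (lam : ℂ) else 0) :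
    ∀ (m : ℕ) (a : Fin m → G) (A B : Matrix (Fin n) (Fin n) ℂ),
      ∫ y : Fin m → G, (∏ t, (w (y t) : ℂ)) * (A * ρ ((List.ofFn fun t => y t * a t).prod) * B).trace
          ∂(Measure.pi fun _ => haarProbability G) =
        (lam : ℂ) ^ m * (A * ρ ((List.ofFn a).prod) * B).trace
  | 0, a, A, B => by
    simp [List.ofFn_zero, measureReal_def]
  | m + 1, a, A, B => by
    set μ := haarProbability G with hμ
    -- split off the coordinate `0`
    have e := measurePreserving_piFinSuccAbove (fun _ : Fin (m + 1) => μ) 0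
    rw [← e.symm.integral_comp' (g := fun y : Fin (m + 1) → G =>
      (∏ t, (w (y t) : ℂ)) * (A * ρ ((List.ofFn fun t => y t * a t).prod) * B).trace)]
    have hsymm : ∀ x : G × (Fin m → G),
        (MeasurableEquiv.piFinSuccAbove (fun _ : Fin (m + 1) => G) 0).symm x = Fin.cons x.1 x.2 := by
      intro x
      rw [MeasurableEquiv.piFinSuccAbove_symm_apply]
      simp [Fin.insertNthEquiv, Fin.insertNth_zero']
    have hG : ∀ x : G × (Fin m → G),
        (fun y : Fin (m + 1) → G => (∏ t, (w (y t) : ℂ)) * (A * ρ ((List.ofFn fun t => y t * a t).prod) * B).trace)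
          ((MeasurableEquiv.piFinSuccAbove (fun _ : Fin (m + 1) => G) 0).symm x) =
        (w x.1 : ℂ) * ((∏ t, (w (x.2 t) : ℂ)) *
          (A * ρ (x.1 * a 0) * ρ ((List.ofFn fun t => x.2 t * a t.succ).prod) * B).trace) := by
      intro x
      rw [hsymm]
      simp only [Fin.prod_univ_succ, Fin.cons_zero, Fin.cons_succ, List.ofFn_succ, List.prod_cons, map_mul]
      simp only [mul_assoc]
    simp_rw [hG]
    -- Fubini
    have hFc : Continuous fun x : G × (Fin m → G) => (w x.1 : ℂ) * ((∏ t, (w (x.2 t) : ℂ)) *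
        (A * ρ (x.1 * a 0) * ρ ((List.ofFn fun t => x.2 t * a t.succ).prod) * B).trace) := by
      have h1 : Continuous fun x : G × (Fin m → G) => A * ρ (x.1 * a 0) :=
        continuous_const.mul (hρ.comp ((continuous_fst).mul continuous_const))
      have h2 : Continuous fun x : G × (Fin m → G) => ρ ((List.ofFn fun t => x.2 t * a t.succ).prod) :=
        hρ.comp ((continuous_ofFn_mul_prod m (fun t => a t.succ)).comp continuous_snd)
      exact (Complex.continuous_ofReal.comp (hw.comp continuous_fst)).mul
        ((continuous_finsetProd _ fun t _ =>
          Complex.continuous_ofReal.comp (hw.comp ((continuous_apply t).comp continuous_snd))).mul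
          ((h1.mul h2).mul continuous_const).matrix_trace)
    have hInt : Integrable (fun x : G × (Fin m → G) => (w x.1 : ℂ) * ((∏ t, (w (x.2 t) : ℂ)) *
        (A * ρ (x.1 * a 0) * ρ ((List.ofFn fun t => x.2 t * a t.succ).prod) * B).trace))
        (μ.prod (Measure.pi fun _ : Fin m => μ)) :=
      hFc.integrable_of_hasCompactSupport (HasCompactSupport.of_compactSpace _)
    rw [integral_prod _ hInt]
    -- inner integral by the induction hypothesis (with `A ↦ A ρ(c₀ a₀)`)
    have hinner : ∀ x : G, ∫ y : Fin m → G, (w x : ℂ) * ((∏ t, (w (y t) : ℂ)) *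
        (A * ρ (x * a 0) * ρ ((List.ofFn fun t => y t * a t.succ).prod) * B).trace)
          ∂(Measure.pi fun _ : Fin m => μ) =
        (w x : ℂ) * ((lam : ℂ) ^ m * (A * ρ (x * a 0) * ρ ((List.ofFn fun t => a t.succ).prod) * B).trace) := by
      intro x
      rw [integral_const_mul, integral_prod_mul_trace_chain hw hρ hM m (fun t => a t.succ) (A * ρ (x * a 0)) B]
    simp_rw [hinner]
    -- outer integral by the trace identity (with `B ↦ ρ(a₀ ⋯) B`)
    have hout : ∀ x : G, (w x : ℂ) * ((lam : ℂ) ^ m *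
        (A * ρ (x * a 0) * ρ ((List.ofFn fun t => a t.succ).prod) * B).trace) =
        (lam : ℂ) ^ m * ((w x : ℂ) * (A * ρ x * (ρ (a 0 * (List.ofFn fun t => a t.succ).prod) * B)).trace) := by
      intro x
      simp only [map_mul, mul_assoc]
      ring
    simp_rw [hout]
    rw [integral_const_mul, integral_mul_trace_mul_eq ρ hw hρ hM, List.ofFn_succ, List.prod_cons]
    simp only [map_mul, pow_succ, mul_assoc]

/-- Real-part form of the Haar chain with a real weight:
`∫ (∏ₜ w(cₜ)) Re tr(A ρ(c₀a₀ ⋯ c_{m−1}a_{m−1}) B) dc = λ^m Re tr(A ρ(a₀ ⋯ a_{m−1}) B)`. [folklore] -/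
theorem integral_prod_mul_re_trace_chain [SecondCountableTopology G] {w : G → ℝ} (hw : Continuous w)
    (hρ : Continuous ρ) {lam : ℝ}
    (hM : ∀ i j, ∫ c, (w c : ℂ) * ρ c i j ∂haarProbability G = if i = j then (lam : ℂ) else 0)
    (m : ℕ) (a : Fin m → G) (A B : Matrix (Fin n) (Fin n) ℂ) :
    ∫ y : Fin m → G, (∏ t, w (y t)) * (A * ρ ((List.ofFn fun t => y t * a t).prod) * B).trace.re
        ∂(Measure.pi fun _ => haarProbability G) =
      lam ^ m * (A * ρ ((List.ofFn a).prod) * B).trace.re := by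
  have hc : Continuous fun y : Fin m → G =>
      (∏ t, (w (y t) : ℂ)) * (A * ρ ((List.ofFn fun t => y t * a t).prod) * B).trace :=
    (continuous_finsetProd _ fun t _ => Complex.continuous_ofReal.comp (hw.comp (continuous_apply t))).mul
      ((continuous_const.mul (hρ.comp (continuous_ofFn_mul_prod m a))).mul continuous_const).matrix_trace
  have hint : Integrable (fun y : Fin m → G =>
      (∏ t, (w (y t) : ℂ)) * (A * ρ ((List.ofFn fun t => y t * a t).prod) * B).trace)
      (Measure.pi fun _ => haarProbability G) :=
    hc.integrable_of_hasCompactSupport (HasCompactSupport.of_compactSpace _)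
  have h1 : (fun y : Fin m → G => (∏ t, w (y t)) * (A * ρ ((List.ofFn fun t => y t * a t).prod) * B).trace.re) =
      fun y => RCLike.re ((∏ t, (w (y t) : ℂ)) * (A * ρ ((List.ofFn fun t => y t * a t).prod) * B).trace) := by
    funext y
    rw [← Complex.ofReal_prod]
    simp only [RCLike.re_to_complex, Complex.re_ofReal_mul]
  rw [h1, integral_re hint, integral_prod_mul_trace_chain ρ hw hρ hM m a A B, ← Complex.ofReal_pow]
  simp only [RCLike.re_to_complex, Complex.re_ofReal_mul]

end General

/-! ### The Schur scalar of `SU(2)` in the fundamental representation -/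

section SUTwo

open Literature.MathematicalPhysics.QuantumLattice (fundamentalRep fundamentalRep_apply su2_apply_10 su2_apply_11)
open Summit.Ventures.LatticeQCDFlow.Exactness (su2a0)
open Summit.Ventures.LatticeQCDFlow.Scoring (onePlaquetteZSU2 onePlaquetteExpectSU2 integral_comp_su2a0_eq_classAngle
  fundamentalRep_trace_re)

/-- `a₀(U) = Re U₀₀` for `U ∈ SU(2)` (`U₁₁ = conj U₀₀`). [folklore] -/
theorem su2a0_eq_re_apply (U : (Matrix.specialUnitaryGroup (Fin 2) ℂ)) :
    su2a0 U = ((U : Matrix (Fin 2) (Fin 2) ℂ) 0 0).re := by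
  unfold su2a0
  rw [Matrix.trace_fin_two, su2_apply_11, Complex.add_re, Complex.conj_re]
  ring

/-- The inverse in `SU(2)` is the conjugate transpose: `(U⁻¹)_{ij} = conj U_{ji}`. [folklore] -/
theorem su2_inv_apply (U : (Matrix.specialUnitaryGroup (Fin 2) ℂ)) (i j : Fin 2) :
    ((U⁻¹ : (Matrix.specialUnitaryGroup (Fin 2) ℂ)) : Matrix (Fin 2) (Fin 2) ℂ) i j =
      (starRingEnd ℂ) ((U : Matrix (Fin 2) (Fin 2) ℂ) j i) := by
  rw [← Matrix.star_eq_inv]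
  change (star (U : Matrix (Fin 2) (Fin 2) ℂ)) i j = _
  rw [Matrix.star_apply, Complex.star_def]

/-- The Wilson weight is a function of `a₀`: `exp(J Re tr U) = exp(2J a₀(U))`. [folklore] -/
theorem su2_weight_eq (J : ℝ) (U : (Matrix.specialUnitaryGroup (Fin 2) ℂ)) :
    Real.exp (J * ((fundamentalRep (Fin 2) U).trace).re) = Real.exp (2 * J * su2a0 U) := by
  rw [fundamentalRep_trace_re]; ring_nf

/-- The Wilson weight is inversion invariant: `a₀(U⁻¹) = a₀(U)`. [folklore] -/
theorem su2a0_inv (U : (Matrix.specialUnitaryGroup (Fin 2) ℂ)) : su2a0 U⁻¹ = su2a0 U := by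
  rw [su2a0_eq_re_apply, su2a0_eq_re_apply, su2_inv_apply, Complex.conj_re]

/-- **The Schur scalar of `SU(2)`**: `∫ exp(J Re tr U) U_{ij} dU = λ_J δ_{ij}`, `λ_J = ∫ exp(2J a₀(U)) a₀(U) dU`
(inversion invariance of the Haar measure: `∫ w U_{ij} = ∫ w conj U_{ji}`, and `U₁₀ = −conj U₀₁`, `U₁₁ = conj U₀₀`).
[folklore] -/
theorem su2_integral_exp_mul_apply (J : ℝ) (i j : Fin 2) :
    ∫ U : (Matrix.specialUnitaryGroup (Fin 2) ℂ), (Real.exp (J * ((fundamentalRep (Fin 2) U).trace).re) : ℂ) *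
        (fundamentalRep (Fin 2) U) i j ∂haarProbability (Matrix.specialUnitaryGroup (Fin 2) ℂ) =
      if i = j then
        ((∫ U : (Matrix.specialUnitaryGroup (Fin 2) ℂ), Real.exp (2 * J * su2a0 U) * su2a0 U
          ∂haarProbability (Matrix.specialUnitaryGroup (Fin 2) ℂ) : ℝ) : ℂ) else 0 := by
  simp_rw [su2_weight_eq, fundamentalRep_apply]
  set μ := haarProbability (Matrix.specialUnitaryGroup (Fin 2) ℂ) with hμ
  set w : (Matrix.specialUnitaryGroup (Fin 2) ℂ) → ℝ := fun U => Real.exp (2 * J * su2a0 U) with hw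
  have hwc : Continuous w := by
    have : Continuous fun U : (Matrix.specialUnitaryGroup (Fin 2) ℂ) => su2a0 U := by
      unfold su2a0
      exact (Complex.continuous_re.comp
        ((continuous_subtype_val :
          Continuous fun U : (Matrix.specialUnitaryGroup (Fin 2) ℂ) =>
            (U : Matrix (Fin 2) (Fin 2) ℂ)).matrix_trace)).div_const _
    exact Real.continuous_exp.comp (continuous_const.mul this)
  have hent : ∀ i j : Fin 2,
      Continuous fun U : (Matrix.specialUnitaryGroup (Fin 2) ℂ) => ((U : Matrix (Fin 2) (Fin 2) ℂ) i j) :=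
    fun i j => (continuous_subtype_val :
      Continuous fun U : (Matrix.specialUnitaryGroup (Fin 2) ℂ) => (U : Matrix (Fin 2) (Fin 2) ℂ)).matrix_elem i j
  have hint : ∀ i j : Fin 2,
      Integrable (fun U : (Matrix.specialUnitaryGroup (Fin 2) ℂ) => (w U : ℂ) * (U : Matrix (Fin 2) (Fin 2) ℂ) i j) μ :=
    fun i j => ((Complex.continuous_ofReal.comp hwc).mul (hent i j)).integrable_of_hasCompactSupport
      (HasCompactSupport.of_compactSpace _)
  -- inversion invariance: `M i j = conj (M j i)`-type identities
  have hinv : ∀ i j : Fin 2, ∫ U, (w U : ℂ) * (U : Matrix (Fin 2) (Fin 2) ℂ) i j ∂μ =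
      ∫ U, (w U : ℂ) * (starRingEnd ℂ) ((U : Matrix (Fin 2) (Fin 2) ℂ) j i) ∂μ := by
    intro i j
    rw [← integral_inv_eq_self
      (fun U : (Matrix.specialUnitaryGroup (Fin 2) ℂ) => (w U : ℂ) * (U : Matrix (Fin 2) (Fin 2) ℂ) i j) μ]
    refine integral_congr_ae (Eventually.of_forall fun U => ?_)
    simp only [hw, su2a0_inv, su2_inv_apply]
  -- real / imaginary split of the diagonal entry `U₀₀ = a₀ + i a₃`
  have hre : ∫ U, (w U : ℂ) * (U : Matrix (Fin 2) (Fin 2) ℂ) 0 0 ∂μ =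
      ∫ U, (((w U * ((U : Matrix (Fin 2) (Fin 2) ℂ) 0 0).re : ℝ) : ℂ) +
        (w U : ℂ) * ((((U : Matrix (Fin 2) (Fin 2) ℂ) 0 0).im : ℂ) * Complex.I)) ∂μ := by
    refine integral_congr_ae (Eventually.of_forall fun U => ?_)
    dsimp only
    conv_lhs => rw [← Complex.re_add_im ((U : Matrix (Fin 2) (Fin 2) ℂ) 0 0)]
    push_cast
    ring
  have hI1 : Integrable
      (fun U : (Matrix.specialUnitaryGroup (Fin 2) ℂ) => (((w U * ((U : Matrix (Fin 2) (Fin 2) ℂ) 0 0).re : ℝ) : ℂ))) μ :=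
    (Complex.continuous_ofReal.comp (hwc.mul (Complex.continuous_re.comp (hent 0 0)))).integrable_of_hasCompactSupport
      (HasCompactSupport.of_compactSpace _)
  have hI2 : Integrable (fun U : (Matrix.specialUnitaryGroup (Fin 2) ℂ) =>
      (w U : ℂ) * ((((U : Matrix (Fin 2) (Fin 2) ℂ) 0 0).im : ℂ) * Complex.I)) μ :=
    ((Complex.continuous_ofReal.comp hwc).mul
      ((Complex.continuous_ofReal.comp (Complex.continuous_im.comp (hent 0 0))).mul
        continuous_const)).integrable_of_hasCompactSupport (HasCompactSupport.of_compactSpace _)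
  -- the imaginary part integrates to zero by inversion invariance
  have him : ∫ U, (w U : ℂ) * ((((U : Matrix (Fin 2) (Fin 2) ℂ) 0 0).im : ℂ) * Complex.I) ∂μ = 0 := by
    have h := hinv 0 0
    rw [hre, integral_add hI1 hI2] at h
    have h2 : ∫ U, (w U : ℂ) * (starRingEnd ℂ) ((U : Matrix (Fin 2) (Fin 2) ℂ) 0 0) ∂μ =
        ∫ U, ((((w U * ((U : Matrix (Fin 2) (Fin 2) ℂ) 0 0).re : ℝ) : ℂ)) -
          (w U : ℂ) * ((((U : Matrix (Fin 2) (Fin 2) ℂ) 0 0).im : ℂ) * Complex.I)) ∂μ := by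
      refine integral_congr_ae (Eventually.of_forall fun U => ?_)
      dsimp only
      conv_lhs => rw [← Complex.re_add_im ((U : Matrix (Fin 2) (Fin 2) ℂ) 0 0)]
      rw [map_add, Complex.conj_ofReal, map_mul, Complex.conj_ofReal, Complex.conj_I]
      push_cast
      ring
    rw [h2, integral_sub hI1 hI2] at h
    -- `X + Y = X - Y` ⇒ `Y = 0`
    linear_combination h / 2
  have hdiag : ∫ U, (((w U * ((U : Matrix (Fin 2) (Fin 2) ℂ) 0 0).re : ℝ) : ℂ)) ∂μ =
      ((∫ U, Real.exp (2 * J * su2a0 U) * su2a0 U ∂μ : ℝ) : ℂ) := by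
    rw [integral_complex_ofReal]
    congr 1
    refine integral_congr_ae (Eventually.of_forall fun U => ?_)
    simp only [hw, su2a0_eq_re_apply]
  fin_cases i <;> fin_cases j
  · -- (0,0)
    simp only [Fin.zero_eta, Fin.isValue, if_true]
    rw [hre, integral_add hI1 hI2, him, add_zero, hdiag]
  · -- (0,1): `M 0 1 = ∫ w conj U₁₀ = −M 0 1`
    simp only [Fin.zero_eta, Fin.mk_one, Fin.isValue, zero_ne_one, if_false]
    have h := hinv 0 1
    have h2 : ∫ U, (w U : ℂ) * (starRingEnd ℂ) ((U : Matrix (Fin 2) (Fin 2) ℂ) 1 0) ∂μ =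
        -∫ U, (w U : ℂ) * (U : Matrix (Fin 2) (Fin 2) ℂ) 0 1 ∂μ := by
      rw [← integral_neg]
      refine integral_congr_ae (Eventually.of_forall fun U => ?_)
      simp only [su2_apply_10, map_neg, Complex.conj_conj, mul_neg]
    rw [h2] at h
    linear_combination h / 2
  · -- (1,0): `M 1 0 = ∫ w conj U₀₁ = −M 1 0`
    simp only [Fin.mk_one, Fin.zero_eta, Fin.isValue, one_ne_zero, if_false]
    have h := hinv 1 0
    have h2 : ∫ U, (w U : ℂ) * (starRingEnd ℂ) ((U : Matrix (Fin 2) (Fin 2) ℂ) 0 1) ∂μ =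
        -∫ U, (w U : ℂ) * (U : Matrix (Fin 2) (Fin 2) ℂ) 1 0 ∂μ := by
      rw [← integral_neg]
      refine integral_congr_ae (Eventually.of_forall fun U => ?_)
      simp only [su2_apply_10, mul_neg, neg_neg]
    rw [h2] at h
    linear_combination h / 2
  · -- (1,1): `U₁₁ = conj U₀₀ = a₀ − i a₃`
    simp only [Fin.mk_one, Fin.isValue, if_true]
    have hre' : ∫ U, (w U : ℂ) * (U : Matrix (Fin 2) (Fin 2) ℂ) 1 1 ∂μ =
        ∫ U, (((w U * ((U : Matrix (Fin 2) (Fin 2) ℂ) 0 0).re : ℝ) : ℂ) -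
          (w U : ℂ) * ((((U : Matrix (Fin 2) (Fin 2) ℂ) 0 0).im : ℂ) * Complex.I)) ∂μ := by
      refine integral_congr_ae (Eventually.of_forall fun U => ?_)
      dsimp only
      rw [su2_apply_11]
      conv_lhs => rw [← Complex.re_add_im ((U : Matrix (Fin 2) (Fin 2) ℂ) 0 0)]
      rw [map_add, Complex.conj_ofReal, map_mul, Complex.conj_ofReal, Complex.conj_I]
      push_cast
      ring
    rw [hre', integral_sub hI1 hI2, him, sub_zero, hdiag]

/-- **The mass of the `SU(2)` Wilson weight in the class angle**: `∫ exp(2J a₀(U)) dU = (2/π) Z₂(2J)`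
(`Z₂(b) = ∫₀^π sin²α e^{b cos α} dα`; Weyl's integration formula of the tree). [folklore] -/
theorem su2_weightMass_eq (J : ℝ) :
    ∫ U : (Matrix.specialUnitaryGroup (Fin 2) ℂ), Real.exp (2 * J * su2a0 U)
        ∂haarProbability (Matrix.specialUnitaryGroup (Fin 2) ℂ) =
      2 / Real.pi * onePlaquetteZSU2 (2 * J) := by
  rw [integral_comp_su2a0_eq_classAngle (fun t => Real.exp (2 * J * t)) (by fun_prop), onePlaquetteZSU2]
  congr 1
  refine intervalIntegral.integral_congr fun α _ => ?_
  ring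

/-- **The Schur scalar of `SU(2)` in the class angle**: `∫ exp(2J a₀) a₀ dU = (2/π) Z₂(2J) ⟨cos α⟩_{2J}`.
[folklore] -/
theorem su2_schurScalar_eq (J : ℝ) :
    ∫ U : (Matrix.specialUnitaryGroup (Fin 2) ℂ), Real.exp (2 * J * su2a0 U) * su2a0 U
        ∂haarProbability (Matrix.specialUnitaryGroup (Fin 2) ℂ) =
      2 / Real.pi * onePlaquetteZSU2 (2 * J) * onePlaquetteExpectSU2 (2 * J) Real.cos := by
  rw [integral_comp_su2a0_eq_classAngle (fun t => Real.exp (2 * J * t) * t) (by fun_prop), onePlaquetteExpectSU2,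
    mul_assoc, mul_div_cancel₀ _ (Summit.Ventures.LatticeQCDFlow.Scoring.onePlaquetteZSU2_pos _).ne']
  congr 1
  refine intervalIntegral.integral_congr fun α _ => ?_
  ring

/-- `∫ exp(2J a₀) dU > 0`. [folklore] -/
theorem su2_weightMass_pos (J : ℝ) :
    0 < ∫ U : (Matrix.specialUnitaryGroup (Fin 2) ℂ), Real.exp (2 * J * su2a0 U)
      ∂haarProbability (Matrix.specialUnitaryGroup (Fin 2) ℂ) := by
  rw [su2_weightMass_eq]
  exact mul_pos (by positivity) (Summit.Ventures.LatticeQCDFlow.Scoring.onePlaquetteZSU2_pos _)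

/-- **The ratio is the one-plaquette character ratio**: `(∫ exp(2J a₀) a₀ dU) / (∫ exp(2J a₀) dU) = ⟨cos α⟩_{2J}`
(`= I₂(2J)/I₁(2J) = u(β_W)` at `β_W = 2J`). [folklore] -/
theorem su2_schurScalar_div_weightMass (J : ℝ) :
    (∫ U : (Matrix.specialUnitaryGroup (Fin 2) ℂ), Real.exp (2 * J * su2a0 U) * su2a0 U
        ∂haarProbability (Matrix.specialUnitaryGroup (Fin 2) ℂ)) /
        (∫ U : (Matrix.specialUnitaryGroup (Fin 2) ℂ), Real.exp (2 * J * su2a0 U)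
          ∂haarProbability (Matrix.specialUnitaryGroup (Fin 2) ℂ)) =
      onePlaquetteExpectSU2 (2 * J) Real.cos := by
  rw [su2_schurScalar_eq, su2_weightMass_eq, mul_div_cancel_left₀]
  exact (mul_pos (by positivity) (Summit.Ventures.LatticeQCDFlow.Scoring.onePlaquetteZSU2_pos (2 * J))).ne'

end SUTwo

end Summit.Ventures.YMGap.FlowData
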